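import Summits.QuantumFields.BalabanUV.T4Continuum.Support.B13StepEnvelopeEndSub

/-!
# NE5 ∕ U3 — E9[rec] ON THE OPERATOR CARRIER OF RECORD `↥measOp` (owner RULING R20: «of record `Op′ := ↥(B13OpMeasurable.measOp …)`,
# `rd := subtypeL`; data of record in it by `assemble_mem_measOp`»): the most-reduced Cauchy END of `B13StepEnvelopeEndSub` with the
# sub-slot FIXED to the measurable slot and the two membership side conditions DISCHARGED from one-run measurability of the raw species

Cell `pub-balaban`, unit `b2b-balaban-t4-ne5-formalise-leaf-03` (NE5 formalisation swarm, LEAF PROVER 03, gen 6; follower of this lineage's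
`Support/B13StepEnvelopeEndSub.lean` p216841 on `Support/B13StepOfRecordSub.lean` p216538 §3).  Summits-side NEW WORK under the LEAN PLACEMENT
RULE (cell bookkeeping; NOT a Literature module; 0 def).  HONEST FRAMING: rung (B)+1 of the FINITE-VOLUME T⁴ continuum programme — NOT infinite
volume, NOT a mass gap, NOT the Clay problem, and **NOT A PROOF OF NE5**: an IMPLICATION whose wall binders — W2-op = `ActOpLineAnalyticOn` over
operator directions IN `measOp` (GAPS G-ne5p1-1′∕1″, NOT PRINTED; after R20 satisfiable in principle, NOT discharged), the per-activity norm
majorant with its decay split and anchored norm ((2.38)∕(1.26) KIND), W1 in row NE2's entry currency, W4, the one-run slice budgets (W3 KIND),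
the quoted levels L05∕L06 ([Balaban1987RG1] (1.18) p. 263 SHAPE), the numerics — are DISPLAYED HYPOTHESES, asserted nowhere (c3∕c4∕c6).
HONEST DEPENDENCY (cell line, verbatim): continuum YM on T⁴ ⇐ BetaPertH ∧ nine spine estimates (0/9 proved); BetaPertH ⇐ (D1) ∧ (D4) ∧
CAP+tail; G-an2-4 gates asym, D1 and NE2/3/4.

WHAT IS PROVED (kernel; `[folklore]`).  For slot packages of record on the SPECIES type `E := Species T κ ι Ω 𝒴` of row O1-b (x-indexed
potential species — the class hit by G-ne5p2-5) READ AT THE TRANSPORTED BACKGROUND (`readAtSlots S₀ ι`, the reading BY CONSTRUCTION):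
* **`exists_ne5_of_record_measOp_envelope_readAt`** — `∃ C₅, NE5 (outA (readAtSlots S₀ ι) E₀ cB) (outB (readAtSlots S₀ ι) E₀ cB) W κ θ′ C₅`
  from: the ONE-RUN MEASURABILITY SIDE CONDITIONS of printed KIND (both runs' raw species format-bounded with measurable `x`-sections on the two
  potential species; the formats' potential weights measurable in `x` — route P2's `assemble_mem_measOp`, via `B13StepOfRecordSub.opA_mem_measOp`∕
  `opB_mem_measOp`), the displayed slice budgets (W3 KIND ×2), the quoted levels L05∕L06, W1 entry data + floor, W4, room ×2, the (2.38)-KIND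
  activity norm majorant `A` of the cores OF RECORD read through the inclusion `↥measOp → OpDatum E` on the measurable sub-slot ball class,
  its decay split and anchored norm `Φ′` (`36Φ′ < 1`), **`ActOpLineAnalyticOn` for the restricted cores over operator directions IN `measOp`**,
  `ActExpLinearOn` with activity data over `↥measOp`, signs, `0 < θ < 1 ≥ θ′ ≥ θ`, `0 < ω < 1`, the two strict size inequalities.
  NO reading, NO arithmetic letter, NO output-level∕term-level W2 statement, NO geometric side condition, NO sub-slot membership binder —
  this is `B13StepEnvelopeEndSub.exists_ne5_of_record_restrict_envelope_readAt` at `M := measOp T κ ι Ω 𝒴` with `hMA`∕`hMB` DISCHARGED.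
So the Cauchy END of record for this lineage now reads, binder by binder, over a carrier on which every operator-ball binder is satisfiable in
principle (R20).  Nothing is asserted about [II]'s kernels ∕ potentials ∕ terms.  0 sorry; axioms ⊆ {propext, Classical.choice, Quot.sound}.
-/

noncomputable section

open scoped BigOperators
open Metric Set MeasureTheory

namespace Summit.QuantumFields.BalabanUV.T4Continuum.B13StepEnvelopeEndMeasOp

open Literature.MathematicalPhysics.QuantumFieldTheory.Balaban1983to89
open Literature.MathematicalPhysics.QuantumFieldTheory.Balaban1983to89.T4OutputRate (Carriers Functional DecayBound NE5)
open Literature.MathematicalPhysics.QuantumFieldTheory.Balaban1983to89.T4InputCauchyRateSpecies (ballClass)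
open Summit.QuantumFields.BalabanUV.T4Continuum.B13Carriers (TwoRuns)
open Summit.QuantumFields.BalabanUV.T4Continuum.B13OpDatum (Format OpDatum Species FormatBounded)
open Summit.QuantumFields.BalabanUV.T4Continuum.B13OpDatumJunctions (opOf RawBounded WeightedEntrywiseRate)
open Summit.QuantumFields.BalabanUV.T4Continuum.B13StepTermLabels (TermIdx InnerLabel)
open Summit.QuantumFields.BalabanUV.T4Continuum.B13StepTermFamily (ActData ActExpLinearOn)
open Summit.QuantumFields.BalabanUV.T4Continuum.B13StepTermSocket (labelsIndexing touchInc)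
open Summit.QuantumFields.BalabanUV.T4Continuum.B13InnerData (Bnd b13InnerData)
open Summit.QuantumFields.BalabanUV.T4Continuum.UrsellTreeSum (ind)
open Summit.QuantumFields.BalabanUV.T4Continuum.UrsellTermBudget (actSum)
open Summit.QuantumFields.BalabanUV.T4Continuum.B13Base (selfCtr)
open Summit.QuantumFields.BalabanUV.T4Continuum.B13DomainGeometryTR (SCube footprint domainGeometry)
open Summit.QuantumFields.BalabanUV.T4Continuum.B13StepOfRecord (Slots assembly step outA outB)
open Summit.QuantumFields.BalabanUV.T4Continuum.B13StepOfRecordSub (assemblyOn restrict opA_mem_measOp opB_mem_measOp)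
open Summit.QuantumFields.BalabanUV.T4Continuum.B13StepOfRecordReadAt (readAtSlots)
open Summit.QuantumFields.BalabanUV.T4Continuum.B13OpMeasurable (measOp)
open Summit.QuantumFields.BalabanUV.T4Continuum.B13TermOpEnvelope (ActOpLineAnalyticOn)
open Summit.QuantumFields.BalabanUV.T4Continuum.B13StepEnvelopeEndSub (exists_ne5_of_record_restrict_envelope_readAt)

variable {G : Type} [GaugeGroup G] {R : TwoRuns G} {T κ ι Ω 𝒴 IOp Hist Ω' : Type*} [MeasurableSpace Ω] [NormedAddCommGroup Hist]
  [NormedSpace ℂ Hist] [MeasurableSpace Ω'] (S₀ : Slots R (Species T κ ι Ω 𝒴) IOp Hist) (ι' : (ℕ → ℝ) → R.carriers.BgA → ℕ → IOp)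
  (E₀ cB : ℝ)

/-- [folklore] **THE MOST-REDUCED CAUCHY END OF RECORD ON THE MEASURABLE OPERATOR CARRIER (R20).**  For a slot package of record on row O1-b's
species type, read at the transported background (`readAtSlots S₀ ι'`) and restricted to `measOp T κ ι Ω 𝒴`: the one-run MEASURABILITY side
conditions (`hbdA`∕`hrawQA`∕`hrawRA`, `hbdB`∕`hrawQB`∕`hrawRB`, `hFQ`∕`hFR` — printed KIND: the (2.19) kernels are functions of the field
configuration), the displayed slice budgets, levels, W1 entry data + floor, W4, room, the activity norm majorant `A` of the cores of record through
the inclusion on the measurable sub-slot ball class with decay split + anchored norm, **`ActOpLineAnalyticOn` over directions IN `measOp`**,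
`ActExpLinearOn` (data over `↥measOp`), signs and the two strict size inequalities IMPLY
`∃ C₅, NE5 (outA (readAtSlots S₀ ι') E₀ cB) (outB (readAtSlots S₀ ι') E₀ cB) W κ θ′ C₅`.  NOT a proof of NE5: an implication from displayed binders;
no binder is a reading, an arithmetic letter or a sub-slot membership. -/
theorem exists_ne5_of_record_measOp_envelope_readAt {W : Set (ℕ → ℝ)} {ROp RHist : ℕ → ℝ}
    {A A' : ℕ → (ℕ → ℝ) → R.carriers.BgB → R.carriers.Dom → InnerLabel R.carriers.Dom (Bnd R) → ℝ}
    {Dt : ActData R.carriers.Dom (InnerLabel R.carriers.Dom (Bnd R)) (measOp T κ ι Ω 𝒴) Hist Ω'} {κ' Φ' EA₀ cA c₁ r₀ δ' θ θ' : ℝ}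
    (hbdA : ∀ g V k, FormatBounded (S₀.F k) (S₀.rawA g V k))
    (hrawQA : ∀ g V k (Y : 𝒴) (b b' : κ), Measurable fun x : Ω => S₀.rawA g V k (.potQ x Y b b'))
    (hrawRA : ∀ g V k (Y : 𝒴), Measurable fun x : Ω => S₀.rawA g V k (.potR x Y))
    (hbdB : ∀ g U k, FormatBounded (S₀.F k) (S₀.rawB g U k))
    (hrawQB : ∀ g U k (Y : 𝒴) (b b' : κ), Measurable fun x : Ω => S₀.rawB g U k (.potQ x Y b b'))
    (hrawRB : ∀ g U k (Y : 𝒴), Measurable fun x : Ω => S₀.rawB g U k (.potR x Y))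
    (hFQ : ∀ k (Y : 𝒴) (b b' : κ), Measurable fun x : Ω => (S₀.F k).wt (.potQ x Y b b'))
    (hFR : ∀ k (Y : 𝒴), Measurable fun x : Ω => (S₀.F k).wt (.potR x Y))
    (hbB : (assembly (readAtSlots S₀ ι')).SliceBudgetB W κ' cB)
    (hbA : (readAtSlots S₀ ι').D.SliceBudget (step (readAtSlots S₀ ι') E₀ cB) W κ' cA)
    (hdA : DecayBound (outA (readAtSlots S₀ ι') E₀ cB) W EA₀ κ') (hdB : DecayBound (outB (readAtSlots S₀ ι') E₀ cB) W E₀ κ')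
    (hRA : RawBounded S₀.F (assembly S₀).rawAt W) (hRB : RawBounded S₀.F S₀.rawB W)
    (hwer : WeightedEntrywiseRate S₀.F (assembly S₀).rawAt S₀.rawB W c₁ fun k => θ ^ k) (hfl : ∀ k, r₀ ≤ S₀.rOp k)
    (hins : (step (readAtSlots S₀ ι') E₀ cB).InsertionRate W κ' E₀ δ' θ)
    (hOp : ∀ k, S₀.rOp k ≤ ROp k) (hHist : ∀ k, (assembly S₀).bHist E₀ cB k + S₀.rHist k ≤ RHist k)
    (hA : ∀ k, ∀ g ∈ W, ∀ (U : R.carriers.BgB) (q : measOp T κ ι Ω 𝒴 × Hist),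
      q ∈ ballClass (selfCtr
          (assemblyOn (restrict (readAtSlots S₀ ι') (measOp T κ ι Ω 𝒴)
            (opA_mem_measOp S₀ hbdA hrawQA hrawRA hFQ hFR) (opB_mem_measOp S₀ hbdB hrawQB hrawRB hFQ hFR))).raw
          (assemblyOn (restrict (readAtSlots S₀ ι') (measOp T κ ι Ω 𝒴)
            (opA_mem_measOp S₀ hbdA hrawQA hrawRA hFQ hFR) (opB_mem_measOp S₀ hbdB hrawQB hrawRB hFQ hFR))).histRef) ROp RHist k g U →
        ∀ X : R.carriers.Dom, R.carriers.scale X = k → ∀ i : TermIdx R.carriers.Dom (Bnd R),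
          (labelsIndexing (domainGeometry R) (b13InnerData R)).Rel k i X → ∀ m,
            ‖S₀.act ((labelsIndexing (domainGeometry R) (b13InnerData R)).poly i m)
                ((labelsIndexing (domainGeometry R) (b13InnerData R)).lab i m) (q.1 : OpDatum (Species T κ ι Ω 𝒴)) q.2‖ ≤
              A k g U ((labelsIndexing (domainGeometry R) (b13InnerData R)).poly i m)
                ((labelsIndexing (domainGeometry R) (b13InnerData R)).lab i m))
    (hA0 : ∀ k g U Z ℓ, 0 ≤ A k g U Z ℓ) (hA0' : ∀ k g U Z ℓ, 0 ≤ A' k g U Z ℓ) (hκ : 0 ≤ κ')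
    (hdec : ∀ k g U Z ℓ, A k g U Z ℓ ≤ A' k g U Z ℓ * Real.exp (-(κ' * (R.carriers.d Z + 5))))
    (hΦ0 : 0 ≤ Φ') (hΦsmall : 36 * Φ' < 1)
    (hΦ : ∀ k, ∀ g ∈ W, ∀ (U : R.carriers.BgB) (q : SCube R),
      ∑ Z ∈ R.domAt k, ind (q ∈ footprint Z) * actSum (b13InnerData R) (A' k g U) k Z * Real.exp ((footprint Z).card) ≤ Φ')
    (hact : ActOpLineAnalyticOn (labelsIndexing (domainGeometry R) (b13InnerData R))
      (restrict (readAtSlots S₀ ι') (measOp T κ ι Ω 𝒴)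
        (opA_mem_measOp S₀ hbdA hrawQA hrawRA hFQ hFR) (opB_mem_measOp S₀ hbdB hrawQB hrawRB hFQ hFR)).act
      (ballClass (selfCtr
          (assemblyOn (restrict (readAtSlots S₀ ι') (measOp T κ ι Ω 𝒴)
            (opA_mem_measOp S₀ hbdA hrawQA hrawRA hFQ hFR) (opB_mem_measOp S₀ hbdB hrawQB hrawRB hFQ hFR))).raw
          (assemblyOn (restrict (readAtSlots S₀ ι') (measOp T κ ι Ω 𝒴)
            (opA_mem_measOp S₀ hbdA hrawQA hrawRA hFQ hFR) (opB_mem_measOp S₀ hbdB hrawQB hrawRB hFQ hFR))).histRef) ROp RHist) W)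
    (hexp : ActExpLinearOn (labelsIndexing (domainGeometry R) (b13InnerData R))
      (restrict (readAtSlots S₀ ι') (measOp T κ ι Ω 𝒴)
        (opA_mem_measOp S₀ hbdA hrawQA hrawRA hFQ hFR) (opB_mem_measOp S₀ hbdB hrawQB hrawRB hFQ hFR)).act Dt
      (ballClass (selfCtr
          (assemblyOn (restrict (readAtSlots S₀ ι') (measOp T κ ι Ω 𝒴)
            (opA_mem_measOp S₀ hbdA hrawQA hrawRA hFQ hFR) (opB_mem_measOp S₀ hbdB hrawQB hrawRB hFQ hFR))).raw
          (assemblyOn (restrict (readAtSlots S₀ ι') (measOp T κ ι Ω 𝒴)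
            (opA_mem_measOp S₀ hbdA hrawQA hrawRA hFQ hFR) (opB_mem_measOp S₀ hbdB hrawQB hrawRB hFQ hFR))).histRef) ROp RHist) W)
    (hE₀ : 0 ≤ E₀) (hcA : 0 ≤ cA) (hcB : 0 ≤ cB) (hc₁ : 0 ≤ c₁) (hr₀ : 0 < r₀) (hδ' : 0 ≤ δ')
    (hθ0 : 0 < θ) (hθ1 : θ < 1) (hθθ' : θ ≤ θ') (hθ'1 : θ' ≤ 1) (hω : 0 < S₀.D.ω) (hω1 : S₀.D.ω < 1)
    (hh : cA * (EA₀ + E₀) < 1 - S₀.D.ω)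
    (hsmall : S₀.D.ω + Φ' / (1 - 36 * Φ') * cA * (1 - S₀.D.ω) / (1 - S₀.D.ω - cA * (EA₀ + E₀)) < θ') :
    ∃ C₅, NE5 (outA (readAtSlots S₀ ι') E₀ cB) (outB (readAtSlots S₀ ι') E₀ cB) W κ' θ' C₅ :=
  exists_ne5_of_record_restrict_envelope_readAt S₀ (measOp T κ ι Ω 𝒴) (opA_mem_measOp S₀ hbdA hrawQA hrawRA hFQ hFR)
    (opB_mem_measOp S₀ hbdB hrawQB hrawRB hFQ hFR) E₀ cB ι' hbB hbA hdA hdB hRA hRB hwer hfl hins hOp hHist hA hA0 hA0' hκ hdec hΦ0 hΦsmall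
    hΦ hact hexp hE₀ hcA hcB hc₁ hr₀ hδ' hθ0 hθ1 hθθ' hθ'1 hω hω1 hh hsmall

end Summit.QuantumFields.BalabanUV.T4Continuum.B13StepEnvelopeEndMeasOp

end
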